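import Literature.MathematicalPhysics.QuantumLattice.PairCorrelations
import Literature.MathematicalPhysics.QuantumLattice.ReducedBCSTorus
import Literature.MathematicalPhysics.QuantumLattice.XYOrder
import HarnessLib

/-!
# Function-field (symbol-class) SOS + KKT certificates of long-range order on tori

Topic `MathematicalPhysics/QuantumLattice`. Definition request `defn-SymbolCertificate` of route
`HubbardSuperconductivity/FunctionFieldCertificate` (card `function-field-kkt-certificates`, D1): a
NEW OBJECT posited by that route — the finitely presented, `L`-uniform refinement of the
finite-range interface `GSCertificate` (route `GSCertificate`, superseded) — filed next to
`DWaveOnePointCertificate.lean` (the one-point, negative-side analogue) and `PairFieldMomentum.lean`.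
Nothing is asserted about existence: the construction items of the route carry it.

## The object (what is finitely presented, what is semantic)

Work in momentum space on the torus `(ℤ/Lℤ)^d`, grid momenta `κ ∈ (ℤ/Lℤ)^d` (angle `2πκ/L`).
* `LaurentSymbol ν d` — Laurent polynomials with RATIONAL coefficients in the variables
  `z_{j,i} = e^{2πi κ_{j,i}/L}` of `ν` momenta (`AddMonoidAlgebra ℚ ((Fin ν × Fin d) →₀ ℤ)`), read on
  the torus of side `L` by `LaurentSymbol.eval L κ` (an algebra map to `ℂ`, a product of
  `torusChar`s); `degree` = `ℓ¹`-degree of the exponents (= range in position space).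
* `RationalWeight d r` — a scalar weight on `r` external momenta: `L^{-e} · N(z) / ∏_c ‖φ_c(κ)‖_L^{q_c}`
  with `N` a Laurent symbol, finitely many declared INFRARED FORMS `φ_c(κ) = Σ_a c_a κ_a` (integer
  `c`) with pole orders `q_c`, and `‖k‖_L = √(2 Σ_i (1 - cos k_i))` the lattice norm (`latticeNorm`,
  `∼ |k|`, zero iff `k = 0`). The declared infrared set is `⋃_c {φ_c = 0}` (for `r = 1`, `c = 1`:
  `{κ = 0}`; for `r = 2`, `c = (1,-1)`: `{κ = κ'}`); the weight is set to `0` there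
  (`RationalWeight.eval`), so weighted sums run over the complement. `poleOrder = Σ_c q_c`. Odd
  orders are expressible (`q = 1` is the floor singled out by the route's necessary-pole lemma,
  Kennedy–Lieb–Shastry's `1/E_k` has `q = 2`); a Laurent polynomial cannot have a single simple zero
  on `𝕋²` (the indices of the zeros of a smooth map `𝕋² → ℂ` sum to `0`), so order `1` at an isolated
  infrared point is not available with polynomial denominators — whence the lattice norm.
* `SymbolOp Λ d r` — a SYMBOL-CLASS OPERATOR FAMILY `G(κ)`, `κ = (κ_1,…,κ_r)` external momenta:
  `L^{-e} Σ_{m ∈ ((ℤ/Lℤ)^d)^n} Σ_t N_t(z(κ,m)) · w_t(κ,m)`, finitely many terms `t`, each a Laurent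
  symbol `N_t` in the `r + n` momenta times a WORD `w_t` of letters `(c, ℓ)` = "mode `ℓ ∈ Λ` at
  momentum `Σ_j c_j (κ,m)_j`" (integer vector `c`: momentum conservation is written, not imposed).
  The alphabet `Λ` and the matrices of its modes come with the model (`MomentumModel.mode`): for the
  Hubbard torus `ℓ = (σ, †?) ↦ c†_{kσ} / c_{kσ}` (`momentumCreation` / `momentumAnnihilation`,
  unitarily normalised), for spin models the Fourier modes `L^{-d/2} Σ_x conj χ_k(x) S^♯_x`.
* `MomentumModel d` bundles a model: alphabet, Hilbert-space index family, modes, Hamiltonians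
  `H_L`, the (already normalised) order observable `M_L` and the sector `K_L ≤ ℂ^{idx L}`;
  instances `hubbardMomentumModel U δ` (`H_L = hubbardTorus 2 L 1 U`, `M_L = L⁻⁴ Δ_d†Δ_d`,
  `K_L = szSector N_L 0`, `N_L = 2⌊(1-δ)L²/2⌋`) and `xyMomentumModel` (`xyTorus 2 L 1`,
  `M_L = L⁻⁴ Σ_{x,y} (S⁰_xS⁰_y + S¹_xS¹_y)`, `K_L = ker S^z_tot`).
* **`TorusSymbolCertificate M deg p a`**: `L`-INDEPENDENT finite lists `(O_j, s_j)` (SOS),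
  `(Q_m, a_m)` (KKT), `(R_c, r_c)` (R-channel) of symbol-class families with rational weights
  (`WeightedSymbolOp`), each graded (`IsGraded deg p`: symbols of degree `≤ deg`, pole order `≤ p`),
  `s_j, a_m ≥ 0` at every grid point (`WeightNonneg`), each `Q_m(κ)` mapping `K_L` into itself; two SEMANTIC families `T_L` (null quadratic form on `K_L`) and
  `E_L` (`-C/L ≤ E_L ≤ C/L` as Hermitian matrices); and the operator IDENTITY, for all even `L ≥ L₀`,
  `M_L - a·1 = Σ_j Σ_κ s_j(κ) O_j(κ)ᴴO_j(κ) + Σ_m Σ_κ a_m(κ) Q_m(κ)ᴴ(H_L Q_m(κ) - Q_m(κ) H_L)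
    + (H_L R_L - R_L H_L) + T_L + E_L`, `R_L = Σ_c Σ_κ r_c(κ) R_c(κ)`.
  `SymbolCertificate U δ deg p a` and `XYSymbolCertificate deg p a` are the two requested instances.
* `MatrixCertificate M L b` — the per-`L` semantic shadow (finitely many matrices `O_i`,
  sector-preserving `Q_i`, `R`, `T` with `M_L - b = Σ O_iᴴO_i + Σ Q_iᴴ[H_L,Q_i] + [H_L,R] + T`), the
  shape of the route's typed target `CertifiedSectorLRO`; `TorusSymbolCertificate.eval`
  (file `SymbolCertificateEval.lean`) produces it at every even `L ≥ L₀` with `b = a - C/L`.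

## Design choices (recorded for the reviewer and the route)

* The identity is required AFTER EVALUATION on every torus (one Lean proof, uniform in `L`), as in
  `TorusOnePointCertificate`; the card's FORMAL identity in the CAR algebra over `ℚ(z, w, …)` read
  at roots of unity is one way to prove this field (support item `SymbolEvaluation` / closure
  lemmas), not part of the type. Coefficients are rational (`U, δ, a : ℚ`); `i` is not a scalar —
  use anti-Hermitian generators (`z^c - z^{-c}`) or the letters `S^±`.
* Sector terms: the request's "two-sided ideal generated by `N - N_L`, `S^z`" is NOT sound
  (`c†_k (N - N_L) c_k` has expectation `-⟨n_k⟩` in the sector); what soundness uses and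
  `CertifiedSectorLRO` states is nullity of the quadratic form on the sector (= left + right ideal),
  which is the field `sectorTerm_null`. `T_L`, `E_L` are semantic: `T_L` acts trivially on `K_L` and
  `E_L` is `O(1/L)` in norm, so neither can carry macroscopic content; the scalar Riemann-sum
  inequalities of the card are whatever proves `‖E_L‖ ≤ C/L` (cf. `BrillouinRiemannSum`).
* Positivity witnesses (`Fejér–Riesz` / weighted SOS) of `s_j ≥ 0` are PROOFS of `sos_nonneg`.
* Normalisation: only powers of `1/L` are explicit (`scaleExp`); a free internal momentum contributes
  a volume factor `L^d` (`|Λ|·1` is a legitimate element of the algebra), so statements about the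
  infrared weight of a certificate (the route's necessary-pole lemma) must concern the evaluated
  weighted channels `a_m(κ) Q_m(κ)ᴴ[H_L, Q_m(κ)]`, `r_c(κ) R_c(κ)`, not the scalar weights alone.
* Usage: declare concrete families by `abbrev` (or `unfold` them first), so that the dependent arity
  index `r + nInt` reduces (`simp` lemmas such as `map_one` match up to reducible unfolding only).
* Not here: closure of symbol-class families under products/commutators/normal ordering, soundness
  (`MatrixCertificate` ⇒ sector ground-state bound), the necessary-pole lemma, any instance.
-/

noncomputable section

namespace Literature.MathematicalPhysics.QuantumLattice

open Matrix Finset Literature.Probability.LatticeModels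
open scoped ComplexConjugate ComplexOrder

/-! ### Laurent symbols on the Brillouin torus and their evaluation at grid momenta -/

/-- Laurent polynomials with rational coefficients in the `ν·d` variables `z_{j,i} = e^{i k_{j,i}}`
(`j < ν` momenta on the `d`-torus): the numerators ("symbols") of the card's rational coefficient
functions. [folklore] -/
abbrev LaurentSymbol (ν d : ℕ) : Type := AddMonoidAlgebra ℚ ((Fin ν × Fin d) →₀ ℤ)

namespace LaurentSymbol

variable {ν d : ℕ}

/-- The `ℓ¹`-degree `Σ_{j,i} |e_{j,i}|` of a Laurent exponent (graph distance of the corresponding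
relative displacement in position space). [folklore] -/
def expDegree (e : (Fin ν × Fin d) →₀ ℤ) : ℕ := ∑ v, (e v).natAbs

/-- The degree of a Laurent symbol: the largest `ℓ¹`-degree of a monomial in its support (`0` for
the zero symbol). [folklore] -/
def degree (f : LaurentSymbol ν d) : ℕ := f.coeff.support.sup expDegree

/-- `χ_{k+k'}(x) = χ_k(x) χ_{k'}(x)` (characters of `(ℤ/Lℤ)^d` in the momentum variable). [folklore] -/
theorem torusChar_add_left {L : ℕ} [NeZero L] (k k' x : TorusSite d L) :
    torusChar (k + k') x = torusChar k x * torusChar k' x := by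
  rw [torusChar_comm, torusChar_add_right, torusChar_comm x k, torusChar_comm x k']

/-- The evaluation character of the torus of side `L` at grid momenta `v = (κ_j)_j`: the exponent
`e` goes to the monomial `∏_j χ_{e_j}(κ_j) = exp(2πi Σ_{j,i} e_{j,i} κ_{j,i} / L)` (`z^e` at
`z_{j,i} = e^{2πi κ_{j,i}/L}`). [folklore] -/
def evalChar (L : ℕ) [NeZero L] (v : Fin ν → TorusSite d L) : AddChar ((Fin ν × Fin d) →₀ ℤ) ℂ where
  toFun e := ∏ j : Fin ν, torusChar (fun i => ((e (j, i) : ℤ) : ZMod L)) (v j)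
  map_zero_eq_one' := by
    refine Finset.prod_eq_one fun j _ => ?_
    convert torusChar_zero_left (v j) using 2
    funext i
    simp
  map_add_eq_mul' e e' := by
    rw [← Finset.prod_mul_distrib]
    refine Finset.prod_congr rfl fun j _ => ?_
    rw [← torusChar_add_left]
    congr 1
    funext i
    simp

/-- Evaluation of Laurent symbols on the torus of side `L` at grid momenta `v`, as a `ℚ`-algebra
map to `ℂ` (`AddMonoidAlgebra.lift` of `evalChar`): `Σ_e q_e z^e ↦ Σ_e q_e ∏_j χ_{e_j}(κ_j)`.
[folklore] -/
def eval (L : ℕ) [NeZero L] (v : Fin ν → TorusSite d L) : LaurentSymbol ν d →ₐ[ℚ] ℂ :=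
  AddMonoidAlgebra.lift ℚ ℂ ((Fin ν × Fin d) →₀ ℤ) (evalChar L v).toMonoidHom

/-- Evaluation of a monomial `q · z^e`. [folklore] -/
theorem eval_single (L : ℕ) [NeZero L] (v : Fin ν → TorusSite d L) (e : (Fin ν × Fin d) →₀ ℤ)
    (q : ℚ) : eval L v (AddMonoidAlgebra.single e q) =
      (q : ℂ) * ∏ j : Fin ν, torusChar (fun i => ((e (j, i) : ℤ) : ZMod L)) (v j) := by
  rw [eval, AddMonoidAlgebra.lift_single, Algebra.smul_def, eq_ratCast]
  rfl

/-- Constants evaluate to themselves. [folklore] -/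
@[simp] theorem eval_single_zero (L : ℕ) [NeZero L] (v : Fin ν → TorusSite d L) (q : ℚ) :
    eval L v (AddMonoidAlgebra.single 0 q) = (q : ℂ) := by
  have h : AddMonoidAlgebra.single (0 : (Fin ν × Fin d) →₀ ℤ) q =
      algebraMap ℚ (LaurentSymbol ν d) q := by
    simp [AddMonoidAlgebra.coe_algebraMap]
  rw [h, AlgHom.commutes, eq_ratCast]

/-- Constants have degree `0`. [folklore] -/
theorem degree_single_zero (q : ℚ) :
    degree (AddMonoidAlgebra.single (0 : (Fin ν × Fin d) →₀ ℤ) q) = 0 := by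
  apply Nat.eq_zero_of_le_zero
  unfold degree
  refine Finset.sup_le fun e he => ?_
  rw [AddMonoidAlgebra.coeff_single] at he
  have h := Finsupp.support_single_subset he
  rw [Finset.mem_singleton] at h
  simp [h, expDegree]

/-- `1` has degree `0`. [folklore] -/
theorem degree_one : degree (1 : LaurentSymbol ν d) = 0 := by
  rw [AddMonoidAlgebra.one_def]
  exact degree_single_zero 1

end LaurentSymbol

/-! ### Rational weights with declared infrared poles -/

/-- The lattice norm `‖k‖_L = √(2 Σ_i (1 - cos(2πk_i/L))) = (Σ_i 4 sin²(πk_i/L))^{1/2}` of a grid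
momentum (`∼ |2πk/L|` near `0`; vanishes iff `k = 0`, `dispersion_latticeMomentum_eq_zero_iff`).
[folklore] -/
def latticeNorm (L : ℕ) {d : ℕ} (k : TorusSite d L) : ℝ :=
  Real.sqrt (2 * dispersion (latticeMomentum L k))

/-- A RATIONAL WEIGHT on `r` external momenta: `L^{-scaleExp} · num(z) / ∏_{(c,q) ∈ poles} ‖Σ_a c_a κ_a‖_L^q`
— a Laurent numerator over powers of lattice norms of declared integer linear forms of the momenta
(the declared infrared set is where some form vanishes). [folklore] -/
structure RationalWeight (d r : ℕ) where
  /-- The power of `1/L` in front (Riemann-sum normalisation, typically `d·r`). -/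
  scaleExp : ℕ
  /-- The Laurent numerator. -/
  num : LaurentSymbol r d
  /-- Declared infrared forms `c : Fin r → ℤ` with their pole orders `q`. -/
  poles : List ((Fin r → ℤ) × ℕ)

namespace RationalWeight

variable {d r : ℕ}

/-- The total declared pole order `Σ q` (an upper bound for the order at every infrared point). [folklore] -/
def poleOrder (w : RationalWeight d r) : ℕ := (w.poles.map Prod.snd).sum

/-- The value `Σ_a c_a κ_a ∈ (ℤ/Lℤ)^d` of an integer linear form on external momenta. [folklore] -/
def formValue {L : ℕ} (c : Fin r → ℤ) (κ : Fin r → TorusSite d L) : TorusSite d L := ∑ a, c a • κ a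

/-- `κ` is ADMISSIBLE (off the declared infrared set): no declared form vanishes at `κ`. [folklore] -/
def Admissible (w : RationalWeight d r) (L : ℕ) (κ : Fin r → TorusSite d L) : Prop :=
  ∀ cq ∈ w.poles, formValue cq.1 κ ≠ 0

/-- Admissibility is decidable (finitely many integer forms on a finite group). [folklore] -/
instance instDecidablePredAdmissible (w : RationalWeight d r) (L : ℕ) :
    DecidablePred (w.Admissible L) :=
  fun _ => by unfold Admissible; infer_instance

/-- The value of the weight at grid momenta `κ` of the torus of side `L`; `0` on the declared
infrared set (so that weighted sums range over its complement). [folklore] -/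
def eval (w : RationalWeight d r) (L : ℕ) [NeZero L] (κ : Fin r → TorusSite d L) : ℂ :=
  if w.Admissible L κ then
    ((L : ℂ) ^ w.scaleExp)⁻¹ * LaurentSymbol.eval L κ w.num /
      (((w.poles.map fun cq => latticeNorm L (formValue cq.1 κ) ^ cq.2).prod : ℝ) : ℂ)
  else 0

/-- Off the admissible set the weight is `0`. [folklore] -/
theorem eval_of_not_admissible (w : RationalWeight d r) (L : ℕ) [NeZero L]
    (κ : Fin r → TorusSite d L) (h : ¬ w.Admissible L κ) : w.eval L κ = 0 := by
  simp [eval, h]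

/-- The constant, pole-free weight `q` (no `1/L`, no declared forms). [folklore] -/
abbrev const (d r : ℕ) (q : ℚ) : RationalWeight d r := ⟨0, AddMonoidAlgebra.single 0 q, []⟩

/-- Every point is admissible for the constant weight. [folklore] -/
theorem admissible_const (q : ℚ) (L : ℕ) (κ : Fin r → TorusSite d L) :
    (const d r q).Admissible L κ := fun cq h => by simp at h

/-- The constant weight evaluates to the constant. [folklore] -/
@[simp] theorem eval_const (q : ℚ) (L : ℕ) [NeZero L] (κ : Fin r → TorusSite d L) :
    (const d r q).eval L κ = (q : ℂ) := by
  rw [eval, if_pos (admissible_const q L κ)]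
  simp

/-- The constant weight has pole order `0`. [folklore] -/
@[simp] theorem poleOrder_const (q : ℚ) : (const d r q).poleOrder = 0 := rfl

end RationalWeight

/-! ### Models presented by momentum modes; symbol-class operator families -/

/-- A lattice model on the tori `(ℤ/Lℤ)^d` presented by MOMENTUM MODES: an alphabet `Letter` of
local degrees of freedom, the Hilbert-space basis `idx L`, the matrix `mode L k ℓ` of letter `ℓ` at
grid momentum `k`, the Hamiltonians `ham L`, the normalised order observable `order L` whose
sector ground-state expectation is to be certified, and the sector `sector L`. [folklore] -/
structure MomentumModel (d : ℕ) : Type 1 where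
  /-- The alphabet of local modes (e.g. `(σ, †?)` for fermions). -/
  Letter : Type
  /-- The basis indexing the Hilbert space of the torus of side `L ≠ 0`. -/
  idx : ∀ (L : ℕ) [NeZero L], Type
  [instFintype : ∀ (L : ℕ) [NeZero L], Fintype (idx L)]
  [instDecidableEq : ∀ (L : ℕ) [NeZero L], DecidableEq (idx L)]
  /-- The matrix of letter `ℓ` at grid momentum `k` on the torus of side `L`. -/
  mode : ∀ (L : ℕ) [NeZero L], TorusSite d L → Letter → Matrix (idx L) (idx L) ℂ
  /-- The Hamiltonian `H_L`. -/
  ham : ∀ (L : ℕ) [NeZero L], Matrix (idx L) (idx L) ℂ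
  /-- The normalised order observable `M_L` (e.g. `L⁻⁴ Δ_d† Δ_d`). -/
  order : ∀ (L : ℕ) [NeZero L], Matrix (idx L) (idx L) ℂ
  /-- The sector `K_L` (e.g. `szSector N_L 0`). -/
  sector : ∀ (L : ℕ) [NeZero L], Submodule ℂ (idx L → ℂ)

/-- The Hilbert-space basis of a momentum model is finite (field `instFintype`). [folklore] -/
instance MomentumModel.fintypeIdx {d : ℕ} (M : MomentumModel d) (L : ℕ) [NeZero L] :
    Fintype (M.idx L) := M.instFintype L

/-- The Hilbert-space basis of a momentum model has decidable equality (field `instDecidableEq`).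
[folklore] -/
instance MomentumModel.decidableEqIdx {d : ℕ} (M : MomentumModel d) (L : ℕ) [NeZero L] :
    DecidableEq (M.idx L) := M.instDecidableEq L

/-- A SYMBOL-CLASS OPERATOR FAMILY with `r` external momenta over the alphabet `Λ`: `nInt`
internal (summed) momenta, a prefactor `L^{-scaleExp}`, and finitely many terms
`(N_t, w_t)` = (Laurent symbol in all `r + nInt` momenta, word of letters `(c, ℓ)` standing for the
mode `ℓ` at momentum `Σ_j c_j κ_j`). [folklore] -/
structure SymbolOp (Λ : Type) (d r : ℕ) where
  /-- Number of internal (summed) momenta. -/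
  nInt : ℕ
  /-- The power of `1/L` in front. -/
  scaleExp : ℕ
  /-- The terms: symbol and word. -/
  terms : List (LaurentSymbol (r + nInt) d × List ((Fin (r + nInt) → ℤ) × Λ))

namespace SymbolOp

variable {d r : ℕ}

/-- All symbols of the family have degree `≤ deg`. [folklore] -/
def DegLE {Λ : Type} (deg : ℕ) (G : SymbolOp Λ d r) : Prop := ∀ t ∈ G.terms, t.1.degree ≤ deg

/-- EVALUATION of a symbol-class family on the torus of side `L` at external momenta `κ`:
`G(κ) = L^{-e} Σ_m Σ_t N_t(z(κ,m)) · ∏_{(c,ℓ) ∈ w_t} mode (Σ_j c_j (κ,m)_j) ℓ`. [folklore] -/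
def eval (M : MomentumModel d) (G : SymbolOp M.Letter d r) (L : ℕ) [NeZero L]
    (κ : Fin r → TorusSite d L) : Matrix (M.idx L) (M.idx L) ℂ :=
  ((L : ℂ) ^ G.scaleExp)⁻¹ • ∑ m : Fin G.nInt → TorusSite d L,
    (G.terms.map fun t => LaurentSymbol.eval L (Fin.append κ m) t.1 •
      (t.2.map fun cl => M.mode L (∑ j, cl.1 j • Fin.append κ m j) cl.2).prod).sum

/-- The constant family `1` (no momenta, the empty word with symbol `1`). [folklore] -/
abbrev one (Λ : Type) (d : ℕ) : SymbolOp Λ d 0 := ⟨0, 0, [(AddMonoidAlgebra.single 0 1, [])]⟩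

/-- The constant family evaluates to the identity matrix. [folklore] -/
@[simp] theorem eval_one (M : MomentumModel d) (L : ℕ) [NeZero L] (κ : Fin 0 → TorusSite d L) :
    (one M.Letter d).eval M L κ = 1 := by
  simp [eval]

/-- The constant family has degree `0`. [folklore] -/
theorem one_degLE (Λ : Type) (d deg : ℕ) : (one Λ d).DegLE deg := by
  intro t ht
  rw [List.mem_singleton] at ht
  subst ht
  exact (LaurentSymbol.degree_single_zero (ν := 0 + 0) (d := d) 1).le.trans (Nat.zero_le _)

end SymbolOp

/-- A symbol-class family together with its rational weight (a pair `(O_j, s_j)`, `(Q_m, a_m)` or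
`(R_c, r_c)` of the certificate), the external arity being part of the data. [folklore] -/
structure WeightedSymbolOp (Λ : Type) (d : ℕ) where
  /-- Number of external (weighted) momenta. -/
  arity : ℕ
  /-- The operator family. -/
  op : SymbolOp Λ d arity
  /-- Its weight. -/
  weight : RationalWeight d arity

namespace WeightedSymbolOp

variable {Λ : Type} {d : ℕ}

/-- The GRADING of a weighted pair: all symbols (of the family and of the weight's numerator) have
degree `≤ deg` and the weight has declared pole order `≤ p`. [folklore] -/
structure IsGraded (deg p : ℕ) (F : WeightedSymbolOp Λ d) : Prop where
  degLE : F.op.DegLE deg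
  num_degree_le : F.weight.num.degree ≤ deg
  poleOrder_le : F.weight.poleOrder ≤ p

/-- The weight of the pair is real and nonnegative at every grid point of every torus (what the
card's Fejér–Riesz / weighted-SOS positivity witnesses prove). [folklore] -/
def WeightNonneg (F : WeightedSymbolOp Λ d) : Prop :=
  ∀ (L : ℕ) [NeZero L] (κ : Fin F.arity → TorusSite d L),
    0 ≤ (F.weight.eval L κ).re ∧ (F.weight.eval L κ).im = 0

/-- The grading is monotone. [folklore] -/
theorem IsGraded.mono {deg deg' p p' : ℕ} {F : WeightedSymbolOp Λ d} (hd : deg ≤ deg')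
    (hp : p ≤ p') (h : F.IsGraded deg p) : F.IsGraded deg' p' :=
  ⟨fun t ht => (h.degLE t ht).trans hd, h.num_degree_le.trans hd, h.poleOrder_le.trans hp⟩

/-- The constant pair: the family `1` with the constant weight `q` (no momenta). [folklore] -/
abbrev const (Λ : Type) (d : ℕ) (q : ℚ) : WeightedSymbolOp Λ d :=
  ⟨0, SymbolOp.one Λ d, RationalWeight.const d 0 q⟩

/-- The constant pair lies in every grade. [folklore] -/
theorem const_isGraded (q : ℚ) (deg p : ℕ) : (const Λ d q).IsGraded deg p :=
  ⟨SymbolOp.one_degLE Λ d deg,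
    (LaurentSymbol.degree_single_zero (ν := 0) (d := d) q).le.trans (Nat.zero_le _), Nat.zero_le _⟩

/-- The constant pair has a nonnegative weight when `q ≥ 0`. [folklore] -/
theorem const_weightNonneg {q : ℚ} (hq : 0 ≤ q) : (const Λ d q).WeightNonneg := by
  intro L _ κ
  simp [hq]

end WeightedSymbolOp

section Sums

variable {d : ℕ} (M : MomentumModel d) (l : List (WeightedSymbolOp M.Letter d))
  (L : ℕ) [NeZero L]

/-- The SOS channel `Σ_j Σ_κ s_j(κ) O_j(κ)ᴴ O_j(κ)` of a list of pairs. [folklore] -/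
def sosSum : Matrix (M.idx L) (M.idx L) ℂ :=
  (l.map fun F => ∑ κ : Fin F.arity → TorusSite d L,
    F.weight.eval L κ • ((F.op.eval M L κ)ᴴ * F.op.eval M L κ)).sum

/-- The KKT channel `Σ_m Σ_κ a_m(κ) Q_m(κ)ᴴ (H_L Q_m(κ) - Q_m(κ) H_L)` of a list of pairs. [folklore] -/
def kktSum : Matrix (M.idx L) (M.idx L) ℂ :=
  (l.map fun F => ∑ κ : Fin F.arity → TorusSite d L,
    F.weight.eval L κ • ((F.op.eval M L κ)ᴴ * (M.ham L * F.op.eval M L κ - F.op.eval M L κ * M.ham L))).sum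

/-- The weighted sum `Σ_c Σ_κ r_c(κ) R_c(κ)` of a list of pairs (the R-channel matrix `R_L`). [folklore] -/
def weightedSum : Matrix (M.idx L) (M.idx L) ℂ :=
  (l.map fun F => ∑ κ : Fin F.arity → TorusSite d L, F.weight.eval L κ • F.op.eval M L κ).sum

variable {M l L}

/-- Prepending a pair adds its term to the SOS channel. [folklore] -/
@[simp] theorem sosSum_cons (F : WeightedSymbolOp M.Letter d) :
    sosSum M (F :: l) L = (∑ κ : Fin F.arity → TorusSite d L,
      F.weight.eval L κ • ((F.op.eval M L κ)ᴴ * F.op.eval M L κ)) + sosSum M l L := by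
  simp [sosSum]

/-- The SOS channel of the constant pair `(1, q)` alone is `q·1`. [folklore] -/
theorem sosSum_const_nil (q : ℚ) :
    sosSum M [WeightedSymbolOp.const M.Letter d q] L = (q : ℂ) • 1 := by
  simp [sosSum]

end Sums

/-! ### The certificate -/

/-- **Function-field (symbol-class) SOS + KKT certificate** of `⟨M_L⟩ ≥ a - O(1/L)` in every
`K_L`-sector ground state of the model `M`, with symbols of degree `≤ deg` and weights of pole order
`≤ p` (see the module docstring for the reading of every field). `L`-independent finite data, two
semantic families, one identity per even torus of side `L ≥ L₀`. [folklore] -/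
structure TorusSymbolCertificate {d : ℕ} (M : MomentumModel d) (deg p : ℕ) (a : ℝ) where
  /-- Threshold side. -/
  L₀ : ℕ
  /-- The constant of the `O(1/L)` remainder. -/
  C : ℝ
  /-- The SOS pairs `(O_j, s_j)`. -/
  sos : List (WeightedSymbolOp M.Letter d)
  /-- The KKT pairs `(Q_m, a_m)`. -/
  kkt : List (WeightedSymbolOp M.Letter d)
  /-- The R-channel pairs `(R_c, r_c)`. -/
  rch : List (WeightedSymbolOp M.Letter d)
  /-- The sector terms `T_L` (semantic). -/
  sectorTerm : ∀ (L : ℕ) [NeZero L], Matrix (M.idx L) (M.idx L) ℂ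
  /-- The remainder `E_L` (semantic). -/
  error : ∀ (L : ℕ) [NeZero L], Matrix (M.idx L) (M.idx L) ℂ
  sos_graded : ∀ F ∈ sos, F.IsGraded deg p
  kkt_graded : ∀ F ∈ kkt, F.IsGraded deg p
  rch_graded : ∀ F ∈ rch, F.IsGraded deg p
  sos_nonneg : ∀ F ∈ sos, F.WeightNonneg
  kkt_nonneg : ∀ F ∈ kkt, F.WeightNonneg
  kkt_sector : ∀ F ∈ kkt, ∀ (L : ℕ) [NeZero L] (κ : Fin F.arity → TorusSite d L)
    (ψ : M.idx L → ℂ), ψ ∈ M.sector L → F.op.eval M L κ *ᵥ ψ ∈ M.sector L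
  sectorTerm_null : ∀ (L : ℕ) [NeZero L] (ψ : M.idx L → ℂ),
    ψ ∈ M.sector L → star ψ ⬝ᵥ sectorTerm L *ᵥ ψ = 0
  error_lower : ∀ (L : ℕ) [NeZero L], L₀ ≤ L → (error L + ((C / L : ℝ) : ℂ) • 1).PosSemidef
  error_upper : ∀ (L : ℕ) [NeZero L], L₀ ≤ L → (((C / L : ℝ) : ℂ) • 1 - error L).PosSemidef
  identity : ∀ (L : ℕ) [NeZero L], L₀ ≤ L → Even L →
    M.order L - (a : ℂ) • (1 : Matrix (M.idx L) (M.idx L) ℂ) =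
      sosSum M sos L + kktSum M kkt L +
        (M.ham L * weightedSum M rch L - weightedSum M rch L * M.ham L) +
        sectorTerm L + error L

/-- The PER-`L` SEMANTIC CERTIFICATE at level `b` (what evaluation of a symbol certificate
produces; the matrix data of the route target `CertifiedSectorLRO` at one side `L`): finitely many
matrices `O_i`, sector-preserving `Q_i`, a matrix `R` and a sector-null `T` with
`M_L - b·1 = Σ_i O_iᴴ O_i + Σ_i Q_iᴴ (H_L Q_i - Q_i H_L) + (H_L R - R H_L) + T`. In a normalised
`K_L`-sector ground state each right-hand term has expectation `≥ 0, ≥ 0, = 0, = 0`. [folklore] -/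
structure MatrixCertificate {d : ℕ} (M : MomentumModel d) (L : ℕ) [NeZero L] (b : ℝ) where
  /-- Number of SOS matrices. -/
  n : ℕ
  /-- Number of KKT matrices. -/
  m : ℕ
  /-- The SOS matrices. -/
  O : Fin n → Matrix (M.idx L) (M.idx L) ℂ
  /-- The KKT matrices. -/
  Q : Fin m → Matrix (M.idx L) (M.idx L) ℂ
  /-- The R-channel matrix. -/
  R : Matrix (M.idx L) (M.idx L) ℂ
  /-- The sector term. -/
  T : Matrix (M.idx L) (M.idx L) ℂ
  sector_pres : ∀ i (ψ : M.idx L → ℂ), ψ ∈ M.sector L → Q i *ᵥ ψ ∈ M.sector L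
  sector_null : ∀ ψ : M.idx L → ℂ, ψ ∈ M.sector L → star ψ ⬝ᵥ T *ᵥ ψ = 0
  identity : M.order L - (b : ℂ) • (1 : Matrix (M.idx L) (M.idx L) ℂ) =
    ∑ i, (O i)ᴴ * O i + ∑ i, (Q i)ᴴ * (M.ham L * Q i - Q i * M.ham L) +
      (M.ham L * R - R * M.ham L) + T

/-! ### The two requested instances -/

/-- The repulsive Hubbard torus presented by momentum modes: letters `(σ, †?)` read as
`c†_{kσ}` / `c_{kσ}` (`momentumCreation` / `momentumAnnihilation`), `H_L = hubbardTorus 2 L 1 U`,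
order observable `L⁻⁴ Δ_d† Δ_d` (`Δ_d = pairField dWaveFormFactor L`), sector `szSector N_L 0`
with `N_L = 2⌊(1-δ)L²/2⌋` — literally the objects of the summit statement. [folklore] -/
abbrev hubbardMomentumModel (U δ : ℚ) : MomentumModel 2 where
  Letter := Fin 2 × Bool
  idx L _ := Finset (Orb (FermionTorus 2 L))
  instFintype := fun _ _ => inferInstance
  instDecidableEq := fun _ _ => inferInstance
  mode _ _ k cl := if cl.2 then momentumCreation k cl.1 else momentumAnnihilation k cl.1
  ham L _ := hubbardTorus 2 L 1 (U : ℝ)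
  order L _ := (1 / (L : ℂ) ^ 4) •
    ((pairField dWaveFormFactor L)ᴴ * pairField dWaveFormFactor L)
  sector L _ := szSector (2 * ⌊(1 - (δ : ℝ)) * (L : ℝ) ^ 2 / 2⌋₊) 0

/-- The spin-`1/2` letters: `inl α ↦ S^α_x` (`α = 0, 1, 2`), `inr true ↦ S⁺_x`, `inr false ↦ S⁻_x`
(redundant, so that rational combinations suffice). [folklore] -/
def spinLetterOp {Λ : Type*} [Fintype Λ] [DecidableEq Λ] (x : Λ) : Fin 3 ⊕ Bool → Op Λ 2
  | Sum.inl α => siteSpin 1 x α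
  | Sum.inr true => onSite x (spinRaise 1)
  | Sum.inr false => onSite x (spinLower 1)

/-- The spin-`1/2` ferromagnetic quantum XY torus presented by momentum modes: letters read as the
Fourier modes `L⁻¹ Σ_x conj χ_k(x) S^♯_x`, `H_L = xyTorus 2 L 1`, order observable
`L⁻⁴ Σ_{x,y} (S⁰_x S⁰_y + S¹_x S¹_y)`, sector `ker S^z_tot` (`totalSpin 1 2`).
[cite: KLS1988PRL, Theorem (the order parameter) and before eq. (2) (the modes `Ŝ_p`)] -/
abbrev xyMomentumModel : MomentumModel 2 where
  Letter := Fin 3 ⊕ Bool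
  idx L _ := TensorIndex (TorusSite 2 L) 2
  instFintype := fun _ _ => inferInstance
  instDecidableEq := fun _ _ => inferInstance
  mode L _ k cl := ∑ x : TorusSite 2 L, (torusFourierWeight 2 L * conj (torusChar k x)) • spinLetterOp x cl
  ham L _ := xyTorus 2 L 1
  order L _ := (1 / (L : ℂ) ^ 4) • ∑ x : TorusSite 2 L, ∑ y : TorusSite 2 L,
    (siteSpin 1 x 0 * siteSpin 1 y 0 + siteSpin 1 x 1 * siteSpin 1 y 1)
  sector L _ := LinearMap.ker (Matrix.toLin' (totalSpin 1 2 : Op (TorusSite 2 L) 2))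

/-- **`SymbolCertificate U δ deg p a`** (the requested notion): a function-field SOS + KKT
certificate, symbols of degree `≤ deg`, pole order `≤ p`, of `d_{x²-y²}` pair order
`L⁻⁴ ⟨Δ_d† Δ_d⟩ ≥ a - C/L` in every `(N_L, S^z = 0)`-sector ground state of `hubbardTorus 2 L 1 U`
on the even tori. Its existence for some rational `U ∈ [4,6]`, `δ ∈ [3/20,1/4]`, `a > 0` is the
route's construction crux, not asserted here. [folklore] -/
abbrev SymbolCertificate (U δ : ℚ) (deg p : ℕ) (a : ℚ) : Type :=
  TorusSymbolCertificate (hubbardMomentumModel U δ) deg p (a : ℝ)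

/-- **`XYSymbolCertificate deg p a`**: the same object for the spin-`1/2` quantum XY torus
`xyTorus 2 L 1`, order observable `L⁻⁴ Σ_{x,y} (S⁰_x S⁰_y + S¹_x S¹_y)`, sector `S^z_tot = 0`
(the calibration instance: Kennedy–Lieb–Shastry's reflection-positivity proof has weights `1/E_k`,
pole order `2`). [cite: KLS1988PRL, Theorem] -/
abbrev XYSymbolCertificate (deg p : ℕ) (a : ℚ) : Type :=
  TorusSymbolCertificate xyMomentumModel deg p (a : ℝ)

/-! ### API: monotonicity in the grading -/

namespace TorusSymbolCertificate

variable {d : ℕ} {M : MomentumModel d} {deg deg' p p' : ℕ} {a : ℝ}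

/-- Certificates form a graded family: raising the degree and pole-order bounds keeps a
certificate. [folklore] -/
def relax (hd : deg ≤ deg') (hp : p ≤ p') (c : TorusSymbolCertificate M deg p a) :
    TorusSymbolCertificate M deg' p' a where
  L₀ := c.L₀
  C := c.C
  sos := c.sos
  kkt := c.kkt
  rch := c.rch
  sectorTerm := c.sectorTerm
  error := c.error
  sos_graded F hF := (c.sos_graded F hF).mono hd hp
  kkt_graded F hF := (c.kkt_graded F hF).mono hd hp
  rch_graded F hF := (c.rch_graded F hF).mono hd hp
  sos_nonneg := c.sos_nonneg
  kkt_nonneg := c.kkt_nonneg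
  kkt_sector := c.kkt_sector
  sectorTerm_null := c.sectorTerm_null
  error_lower := c.error_lower
  error_upper := c.error_upper
  identity := c.identity

end TorusSymbolCertificate

end Literature.MathematicalPhysics.QuantumLattice

end
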